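/-
Copyright (c) 2026 the pub-hodgecm-mathlib formalisation cell (harness21).  Prover seat hodgecm-mathlib-K2E1-p02 (g6), Track B ∕ K2-LIT (build stream 29),
h413 = `stmt-HodgeConjecture-24833`, line `K2_E1_TraceFormulaBeta`, campaign «EIS-R7-BL-SPH-2» (Bernstein–Lapid soft continuation), file P6′ (ℓ11) «L² + SELF-ADJOINT» UNIQUENESS;
dealer K2E1-plan (g5) RULING 2026-09-04T09:23:38Z («REPLACEMENT (ℓ11 := P6′) … FILE P6′ → K2E1-p02 (g6) NOW»), §1 = the ★-closed half.
-/
import Summits.HodgeConjecture.HodgeConjecture.Theorems.K2E1BLUniquenessU2          -- ★ p858816 (K2-defs1 g5) P6: `tendsto_integral_mul_borelHeight_rpow_atTop`, `integral_ofReal_mul_cpow_ofReal`, `exists_ne_zero_one_lt_borelHeight`, `one_mem_closure_…_two` (+ ★ P5 `differentiable_integral_mul_borelHeight_cpow`)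
import Literature.NumberTheory.Automorphic.IntegratedOperatorStar                  -- ★ `ContRepresentation.adjoint_integratedOperator` (`π(f)^* = π(f^*)`)
import Literature.NumberTheory.Automorphic.AutomorphicSpectrumProofs               -- ★ `isStronglyContinuous_rightRegular_holds` (+ ★ `rightRegular`, `isUnitary_rightRegular`)
import Mathlib.Analysis.Complex.OpenMapping
import Summits.HodgeConjecture.HodgeConjecture.Theorems.K2E1BLHeckeOperatorHXU2         -- ★ p858962 (K2E1-p09 g6) P3-C file A: `supHeight_pos`, `measurable_weightX` (+ ★ leaf 1 `HX`)
import Summits.HodgeConjecture.HodgeConjecture.Theorems.K2E1SmoothedCuspFormConstantTerm -- ★ p855950 (K2E1-p02 g2): `orbitalSmoothing_congr_ae_automorphic` (+ ★ p855777 `integratedOperator_rightRegular_ae_eq_orbitalSmoothing`)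
import HarnessLib

/-!
# h413 ∕ Track B «K2-LIT», campaign «EIS-R7-BL-SPH-2» — file P6′ `K2E1BLUniquenessSelfAdjointU2`, §1 (★-closed): `R(h)` IS SELF-ADJOINT ON `L²(G(F)∖G(𝔸))` FOR A SYMMETRIC REAL
# TEST FUNCTION, HAS NO NON-REAL EIGENVALUES, AND THE SPHERICAL TRANSFORM `ĥ` TAKES NON-REAL VALUES ON EVERY BALL OF THE GODEMENT HALF-PLANE (the set `U₀` of the uniqueness step)

Cell `pub/hodgecm-mathlib`, crux H413 = `stmt-HodgeConjecture-24833`, route of record `HCCMUnconditional`; chair K2-lead (g1), dealer K2E1-plan (g5): RULING 09:23:38Z on K2E3-p12 (g7)'s P8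
letter list — ★ P6 `bl_pair_unique` lives on `{‖T_k‖ < |ĥ|}`, disjoint from the existence region, so the uniqueness letter `hunq` of P8 proper is REPLACED by «L² + SELF-ADJOINT» (ℓ11 := P6′):
two solutions of the `𝔛`-system on a ball differ by a HOMOGENEOUS solution `ψ′` (`T_i ψ′ = ĥ_i(z)ψ′`, constant term `b′α₂(z)`), which (i) is genuinely in `L²(μ)` (§2, on the letters),
(ii) is then an eigenvector of the SELF-ADJOINT operator `R(h_i)` on `L²(G(F)∖G(𝔸), μ)` — for the symmetric real test functions `h_i := η_i^∨ ∗ η_i` of the amended spec —, (iii) with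
eigenvalue `ĥ_i(z)`, NON-REAL for `z ∈ U₀ := ball ∩ {1 < Re} ∩ {Im ĥ_{i₀} ≠ 0}`; hence `ψ′ = 0`, `b′ = 0` [BernsteinLapid2019, §4 Claim 2 and Thm 2.3 (the uniqueness input `hunq` on a
non-empty open subset of the domain)].  THIS FILE = §1, the ★-closed half: (ii) self-adjointness, (iii) no non-real eigenvalues, (iv) `U₀` is open and non-empty.  §2 ((i) `memLp_two_of_
homogeneous_solution` and the HEAD `xSystem_psi_unique_on_U₀` feeding ★ G-c `xSystem_existsUnique_of`) follows on the letters of ★ leaf 2 ∕ K2 ∕ P3-C.  THEOREMS ONLY (no `def`, no `instance`,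
no `notation`, no named-fact hypothesis, no `sorry`); lane `--kind proof --supports stmt-HodgeConjecture-24833 --as helper` (count-neutral).

* §1.1 (any adelic group datum `𝒢`, automorphic `μ`, `ν` finite on compacts and inversion invariant) **`adjoint_integratedOperator_rightRegular_of_symm`**: for `η ∈ C_c(G(𝔸), ℂ)` with
  `η(g⁻¹) = η(g)` and `conj (η g) = η g`, the operator `R(η) = (𝒢.rightRegular μ).integratedOperator … ν η` on `L²(μ)` is its own adjoint (★ `adjoint_integratedOperator`: `R(η)^* = R(η^*)`,
  and `η^* = η`); `isSelfAdjoint_integratedOperator_rightRegular_of_symm`.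
* §1.2 (any complex Hilbert space) **`eq_zero_of_isSelfAdjoint_of_apply_eq_smul`**: a self-adjoint `T` with `T ψ = λ • ψ` and `Im λ ≠ 0` has `ψ = 0`; instance
  `eq_zero_of_integratedOperator_rightRegular_eq_smul`.
* §1.3 (complex analysis + ★ P5∕P6) `exists_mem_im_ne_zero_of_differentiable` (an entire non-constant function takes a non-real value on every non-empty open set: Mathlib open mapping
  `AnalyticOnNhd.is_constant_or_isOpen` + identity theorem), `not_forall_eq_of_tendsto_atTop` (a function tending to `+∞` along the reals is not constant), and **`isOpen_uniqueSetSA`** ∕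
  **`uniqueSetSA_nonempty`**: for `h ≥ 0` continuous of compact support with `h(g₀) ≠ 0` at a point of height `> 1` (★ `exists_ne_zero_one_lt_borelHeight` + ★ `one_mem_closure_…_two` give it
  from `h(1) ≠ 0`), `U₀(n) = ball 0 (n+2) ∩ {1 < Re z} ∩ {Im ĥ(z) ≠ 0}` is open and non-empty, `ĥ(z) = ∫ h(x) H(x)^z dμ_G` (★ `differentiable_integral_mul_borelHeight_cpow` entire, ★
  `tendsto_integral_mul_borelHeight_rpow_atTop`); `uniqueSetSA_nonempty_two` (`N = 2`, hypothesis-free in `g₀`).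

* §2 (appended 2nd edition, hypothesis-first, rank-generic `N`) — P8 PROPER'S LETTER `hunq` IN ITS OWN BYTES (★ `K2E1SphericalEisensteinMeromorphicBallU2`, dealer 09:33:29Z «quantify
  against the GIVEN solution `eX` with its `hsol*` as hypotheses»; threshold-parametric `σ₀ < Re z` per 09:33:42Z): `absolutelyContinuous_withDensity_weightX` (`μ ≪ w₁^{−2k}μ`), the
  `L²`-BRIDGE `exists_memLp_toLp_eq_integratedOperator_of_ae_eq` (P3-C's bytes `hT : T u =ᵐ[w₁^{−2k}μ] (ξ ↦ ∫ h y·u(y⁻¹•ξ) ∂νG)` ⟹ on `L²`-classes `T = R(h)`), and the HEADS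
  **`hunq_of_memLp_of_lt (σ₀ n i₀)`** ∕ **`hunq_of_memLp_two`** (`N = 2`, `σ₀ = 1`, non-emptiness discharged by §1.3): from ONE symmetric real test function `h_{i₀}` with `T_{i₀}` of
  P3-C's shape, the given solution `(eX, bX)` (`hsolT hsolC hsolQ`, ★ P8 §2's bytes with `ι P α₁ α₂ Q` abstract) and the `L²`-LETTER `hL2` («a homogeneous solution at a point of
  `U₀ = ball 0 (n+2) ∩ {σ₀ < Re} ∩ {Im ĥ_{i₀} ≠ 0}` is in `L²(μ)`», item (i), §3), conclude `∃ U₀` open non-empty `⊆ ball ∩ {σ₀ < Re}` on which every solution `(ψ, b)` has `ψ = eX z`.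

HONEST LABEL.  Count-neutral helper of the BL-SPH-2 template (consumer: P8 proper's `hunq` via §2 and ★ G-c); closes no socket; HC_CM is proved only modulo the 7 printed citations (2
remaining named inputs: hLiu418 = `stmt-HodgeConjecture-24832`, h413 = `stmt-HodgeConjecture-24833`) until rung 0 closes.

## References
* [BernsteinLapid2019] J. Bernstein, E. Lapid, *On the meromorphic continuation of Eisenstein series*, J. Amer. Math. Soc. 37 (2024) (arXiv:1911.02342), Thm 2.3, §4 Claims 1–2 (p. 9).
* [DeitmarEchterhoff2014] A. Deitmar, S. Echterhoff, *Principles of Harmonic Analysis*, 2nd ed. (2014), Prop. 6.2.1 (`π(f)^* = π(f^*)`).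
* [MoeglinWaldspurger1995] C. Mœglin, J.-L. Waldspurger, *Spectral Decomposition and Eisenstein Series* (1995), II.1.2, IV.1.9.
* [Langlands1976] R. P. Langlands, *On the Functional Equations Satisfied by Eisenstein Series*, LNM 544 (1976), §6 p. 167.
-/

set_option autoImplicit false
-- the mandated namespace repeats `HodgeConjecture.HodgeConjecture`, as in every `Theorems/*.lean` of this sub-problem
set_option linter.dupNamespace false

noncomputable section

open MeasureTheory Measure Set NumberField IsDedekindDomain Filter Topology Metric CompactlySupported
open scoped NNReal ENNReal InnerProductSpace ComplexConjugate
open Literature.NumberTheory.Automorphic Literature.NumberTheory.Automorphic.UnitaryGroup AdelicGroupData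
open Summit.HodgeConjecture.HodgeConjecture.Cruxes.H413.K2E1BLUniquenessU2
open Summit.HodgeConjecture.HodgeConjecture.Cruxes.H413.K2E1SphericalHeckeEigenSectionU2

namespace Summit.HodgeConjecture.HodgeConjecture.Cruxes.H413.K2E1BLUniquenessSelfAdjointU2

/-! ## §1.1 `R(η)` is self-adjoint on `L²(G(F)∖G(𝔸))` for a symmetric real `η` -/

section SelfAdjoint

variable {K : Type} [Field K] [NumberField K] (𝒢 : AdelicGroupData.{0} K)
  (μ : Measure 𝒢.automorphicQuotient) [𝒢.IsAutomorphicMeasure μ]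
  [MeasurableSpace 𝒢.Adelic] [BorelSpace 𝒢.Adelic] (ν : Measure 𝒢.Adelic) [IsFiniteMeasureOnCompacts ν] [ν.IsInvInvariant]

/-- **`R(η)^* = R(η)` FOR A SYMMETRIC REAL TEST FUNCTION** (`η(g⁻¹) = η(g)`, `conj η = η`): the integrated operator of the right regular representation on `L²(G(F)∖G(𝔸), μ)` (★ `rightRegular`,
unitary ★ `isUnitary_rightRegular`, strongly continuous ★ `isStronglyContinuous_rightRegular_holds`) with respect to an inversion-invariant `ν` is its own adjoint, because `η^* = η`
(★ `ContRepresentation.adjoint_integratedOperator`: `π(f)^* = π(f^*)`, `f^*(x) = conj f(x⁻¹)`). [cite: DeitmarEchterhoff2014, Prop. 6.2.1] [cite: BernsteinLapid2019, §4 Claim 2 (p. 9)] -/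
theorem adjoint_integratedOperator_rightRegular_of_symm (η : C_c(𝒢.Adelic, ℂ)) (hsymm : ∀ g, η g⁻¹ = η g) (hreal : ∀ g, conj (η g) = η g) :
    ContinuousLinearMap.adjoint ((𝒢.rightRegular μ).integratedOperator (𝒢.isUnitary_rightRegular μ) (𝒢.isStronglyContinuous_rightRegular_holds μ) ν η) =
      (𝒢.rightRegular μ).integratedOperator (𝒢.isUnitary_rightRegular μ) (𝒢.isStronglyContinuous_rightRegular_holds μ) ν η :=
  ContRepresentation.adjoint_integratedOperator (𝒢.isUnitary_rightRegular μ) (𝒢.isStronglyContinuous_rightRegular_holds μ) ν η η fun x => by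
    rw [mulStar_apply, hsymm, hreal]

/-- Hence `R(η)` is SELF-ADJOINT on `L²(μ)` for a symmetric real `η`. [cite: DeitmarEchterhoff2014, Prop. 6.2.1] [cite: BernsteinLapid2019, §4 Claim 2 (p. 9)] -/
theorem isSelfAdjoint_integratedOperator_rightRegular_of_symm (η : C_c(𝒢.Adelic, ℂ)) (hsymm : ∀ g, η g⁻¹ = η g) (hreal : ∀ g, conj (η g) = η g) :
    IsSelfAdjoint ((𝒢.rightRegular μ).integratedOperator (𝒢.isUnitary_rightRegular μ) (𝒢.isStronglyContinuous_rightRegular_holds μ) ν η) :=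
  (ContinuousLinearMap.isSelfAdjoint_iff' ).2 (adjoint_integratedOperator_rightRegular_of_symm 𝒢 μ ν η hsymm hreal)

end SelfAdjoint

/-! ## §1.2 A self-adjoint operator has no non-real eigenvalues -/

section Eigen

variable {V : Type*} [NormedAddCommGroup V] [InnerProductSpace ℂ V] [CompleteSpace V]

/-- **A SELF-ADJOINT OPERATOR HAS NO NON-REAL EIGENVALUES**: if `T = T^*`, `T ψ = λ ψ` and `Im λ ≠ 0`, then `ψ = 0` (`conj λ ‖ψ‖² = ⟪λψ, ψ⟫ = ⟪Tψ, ψ⟫ = ⟪ψ, Tψ⟫ = λ ‖ψ‖²`). [folklore]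
[cite: BernsteinLapid2019, §4 Claim 2 (p. 9)] -/
theorem eq_zero_of_isSelfAdjoint_of_apply_eq_smul {T : V →L[ℂ] V} (hT : IsSelfAdjoint T) {lam : ℂ} (hlam : lam.im ≠ 0) {ψ : V} (hψ : T ψ = lam • ψ) : ψ = 0 := by
  have hsym : ⟪T ψ, ψ⟫_ℂ = ⟪ψ, T ψ⟫_ℂ := hT.isSymmetric ψ ψ
  rw [hψ, inner_smul_left, inner_smul_right] at hsym
  have hnorm : ((conj lam - lam) : ℂ) * ⟪ψ, ψ⟫_ℂ = 0 := by rw [sub_mul, hsym, sub_self]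
  rcases mul_eq_zero.1 hnorm with h | h
  · exfalso
    apply hlam
    have h' := congrArg Complex.im (sub_eq_zero.1 h)
    rw [Complex.conj_im] at h'
    linarith
  · exact inner_self_eq_zero.1 h

variable {K : Type} [Field K] [NumberField K] (𝒢 : AdelicGroupData.{0} K)
  (μ : Measure 𝒢.automorphicQuotient) [𝒢.IsAutomorphicMeasure μ]
  [MeasurableSpace 𝒢.Adelic] [BorelSpace 𝒢.Adelic] (ν : Measure 𝒢.Adelic) [IsFiniteMeasureOnCompacts ν] [ν.IsInvInvariant]

/-- **`R(η)` HAS NO NON-REAL EIGENVALUES ON `L²(G(F)∖G(𝔸))`** for a symmetric real test function `η`: `R(η) u = λ u`, `Im λ ≠ 0` ⟹ `u = 0` (§1.1 + the previous lemma). This is the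
mechanism of the «L² + SELF-ADJOINT» uniqueness: a homogeneous solution of the `𝔛`-system in `L²` is such an eigenvector with `λ = ĥ(z)`, non-real on `U₀` (§1.3). [cite: BernsteinLapid2019, §4 Claim 2 (p. 9)] -/
theorem eq_zero_of_integratedOperator_rightRegular_eq_smul (η : C_c(𝒢.Adelic, ℂ)) (hsymm : ∀ g, η g⁻¹ = η g) (hreal : ∀ g, conj (η g) = η g)
    {lam : ℂ} (hlam : lam.im ≠ 0) {u : 𝒢.L2 μ}
    (hu : (𝒢.rightRegular μ).integratedOperator (𝒢.isUnitary_rightRegular μ) (𝒢.isStronglyContinuous_rightRegular_holds μ) ν η u = lam • u) : u = 0 :=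
  eq_zero_of_isSelfAdjoint_of_apply_eq_smul (isSelfAdjoint_integratedOperator_rightRegular_of_symm 𝒢 μ ν η hsymm hreal) hlam hu

end Eigen

/-! ## §1.3 The set `U₀ = ball ∩ {1 < Re} ∩ {Im ĥ ≠ 0}` is open and non-empty -/

section UniqueSet

/-- **An entire non-constant function takes a non-real value on every non-empty open set** (Mathlib open mapping `AnalyticOnNhd.is_constant_or_isOpen` on the preconnected `univ`: the image of
a non-empty open set is open in `ℂ`, hence not inside `ℝ`). [folklore] -/
theorem exists_mem_im_ne_zero_of_differentiable {f : ℂ → ℂ} (hf : Differentiable ℂ f) (hnc : ¬ ∃ w : ℂ, ∀ z, f z = w) {W : Set ℂ} (hW : IsOpen W) (hWne : W.Nonempty) :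
    ∃ z ∈ W, (f z).im ≠ 0 := by
  have hana : AnalyticOnNhd ℂ f Set.univ := hf.differentiableOn.analyticOnNhd isOpen_univ
  rcases hana.is_constant_or_isOpen isPreconnected_univ with ⟨w, hw⟩ | hopen
  · exact absurd ⟨w, fun z => hw z (Set.mem_univ z)⟩ hnc
  · -- `f '' W` is open and non-empty; an open non-empty subset of `ℂ` is not contained in `ℝ`
    have hWo : IsOpen (f '' W) := hopen W (Set.subset_univ W) hW
    obtain ⟨z₀, hz₀⟩ := hWne
    obtain ⟨ε, hε, hball⟩ := Metric.isOpen_iff.1 hWo (f z₀) (Set.mem_image_of_mem f hz₀)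
    have hmem : f z₀ + (ε / 2 : ℝ) * Complex.I ∈ f '' W := hball (by
      rw [Metric.mem_ball, dist_eq_norm, add_sub_cancel_left, norm_mul, Complex.norm_real, Complex.norm_I, mul_one, Real.norm_eq_abs, abs_of_pos (half_pos hε)]
      exact half_lt_self hε)
    obtain ⟨z, hz, hzf⟩ := hmem
    by_cases h0 : (f z₀).im = 0
    · refine ⟨z, hz, ?_⟩
      have him : (f z₀ + ((ε / 2 : ℝ) : ℂ) * Complex.I).im = ε / 2 := by simp [h0]
      rw [hzf, him]
      exact (half_pos hε).ne'
    · exact ⟨z₀, hz₀, h0⟩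

/-- **A function tending to `+∞` along the reals is not constant.** [folklore] -/
theorem not_forall_eq_of_tendsto_atTop {f : ℂ → ℂ} {g : ℝ → ℝ} (hg : Tendsto g atTop atTop) (hfg : ∀ σ : ℝ, f σ = (g σ : ℂ)) : ¬ ∃ w : ℂ, ∀ z, f z = w := by
  rintro ⟨w, hw⟩
  have hconst : g = fun _ => w.re := funext fun σ => by
    have h := hw σ
    rw [hfg] at h
    rw [← h, Complex.ofReal_re]
  rw [hconst] at hg
  exact not_tendsto_const_atTop w.re atTop hg

variable {F E : Type} [Field F] [NumberField F] [Field E] [NumberField E] [Algebra F E] {c : E ≃ₐ[F] E} {N : ℕ} [NeZero N]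
  [MeasurableSpace (quasiSplit F E c N).Adelic] [BorelSpace (quasiSplit F E c N).Adelic]

/-- **`U₀(n)` IS OPEN**: `ball 0 (n+2) ∩ {1 < Re z} ∩ {Im ĥ(z) ≠ 0}` for the ENTIRE `ĥ(z) = ∫ h(x)·H(x)^z dμ_G` (★ `differentiable_integral_mul_borelHeight_cpow`). [cite: BernsteinLapid2019, Thm 2.3] -/
theorem isOpen_uniqueSetSA (μG : Measure (quasiSplit F E c N).Adelic) [IsFiniteMeasureOnCompacts μG] {h : (quasiSplit F E c N).Adelic → ℂ} (hh : Continuous h) (hhs : HasCompactSupport h)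
    (n : ℕ) :
    IsOpen (ball (0 : ℂ) (n + 2) ∩ {z : ℂ | 1 < z.re} ∩ {z : ℂ | (∫ x, h x * (((borelHeight x : ℝ≥0) : ℝ) : ℂ) ^ z ∂μG).im ≠ 0}) :=
  (isOpen_ball.inter (isOpen_lt continuous_const Complex.continuous_re)).inter
    (isOpen_ne_fun (Complex.continuous_im.comp (differentiable_integral_mul_borelHeight_cpow μG hh hhs).continuous) continuous_const)

/-- **`U₀(n)` IS NON-EMPTY** for `h ≥ 0` continuous of compact support with `h(g₀) ≠ 0` at a point `g₀` of height `> 1`, `μ_G` finite on compacts and positive on opens (Haar): `ĥ` is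
entire and `ĥ(σ) → +∞` along the reals (★ `tendsto_integral_mul_borelHeight_rpow_atTop`), so `ĥ` is not constant and takes a non-real value on the non-empty open `ball 0 (n+2) ∩ {1 < Re}`.
[cite: BernsteinLapid2019, §4 Claim 1 and Thm 2.3] [cite: Langlands1976, §6 p. 167] -/
theorem uniqueSetSA_nonempty (μG : Measure (quasiSplit F E c N).Adelic) [IsFiniteMeasureOnCompacts μG] [μG.IsOpenPosMeasure]
    {h : (quasiSplit F E c N).Adelic → ℝ} (hh : Continuous h) (hhs : HasCompactSupport h) (h0 : ∀ x, 0 ≤ h x)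
    {g₀ : (quasiSplit F E c N).Adelic} (hg₀ : h g₀ ≠ 0) (hH : 1 < borelHeight g₀) (n : ℕ) :
    (ball (0 : ℂ) (n + 2) ∩ {z : ℂ | 1 < z.re} ∩ {z : ℂ | (∫ x, (h x : ℂ) * (((borelHeight x : ℝ≥0) : ℝ) : ℂ) ^ z ∂μG).im ≠ 0}).Nonempty := by
  have hhc : Continuous fun x => (h x : ℂ) := Complex.continuous_ofReal.comp hh
  have hhsc : HasCompactSupport fun x => (h x : ℂ) := hhs.comp_left Complex.ofReal_zero
  have hent := differentiable_integral_mul_borelHeight_cpow μG hhc hhsc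
  have hnc := not_forall_eq_of_tendsto_atTop (f := fun z : ℂ => ∫ x, (h x : ℂ) * (((borelHeight x : ℝ≥0) : ℝ) : ℂ) ^ z ∂μG)
    (g := fun σ : ℝ => ∫ x, h x * ((borelHeight x : ℝ≥0) : ℝ) ^ σ ∂μG)
    (tendsto_integral_mul_borelHeight_rpow_atTop μG hh hhs h0 hg₀ hH) (fun σ => integral_ofReal_mul_cpow_ofReal μG h σ)
  -- the open set `ball 0 (n+2) ∩ {1 < Re}` is non-empty (it contains `3/2`)
  have hWo : IsOpen (ball (0 : ℂ) (n + 2) ∩ {z : ℂ | 1 < z.re}) := isOpen_ball.inter (isOpen_lt continuous_const Complex.continuous_re)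
  have hWne : (ball (0 : ℂ) (n + 2) ∩ {z : ℂ | 1 < z.re}).Nonempty := by
    refine ⟨((3 / 2 : ℝ) : ℂ), ?_, ?_⟩
    · rw [Metric.mem_ball, dist_zero_right, Complex.norm_real, Real.norm_eq_abs, abs_of_pos (by norm_num)]
      have : (0 : ℝ) ≤ n := Nat.cast_nonneg n
      linarith
    · show (1 : ℝ) < ((3 / 2 : ℝ) : ℂ).re
      rw [Complex.ofReal_re]; norm_num
  obtain ⟨z, hz, hzim⟩ := exists_mem_im_ne_zero_of_differentiable hent hnc hWo hWne
  exact ⟨z, hz, hzim⟩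

/-- **`U₀(n)` IS NON-EMPTY, `N = 2`, from `h(1) ≠ 0`** (`c² = 1`; the point of height `> 1` comes from ★ `one_mem_closure_setOf_one_lt_borelHeight_two` + ★ `exists_ne_zero_one_lt_borelHeight`) —
the shape P8 proper consumes with the symmetric test functions `h_i = η_i^∨ ∗ η_i` (`h_i ≥ 0`, `h_i(1) = ‖η_i‖₂² > 0`). [cite: BernsteinLapid2019, §4 Claim 1 and Thm 2.3] -/
theorem uniqueSetSA_nonempty_two {F E : Type} [Field F] [NumberField F] [Field E] [NumberField E] [Algebra F E] {c : E ≃ₐ[F] E} (hc : c * c = 1)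
    [MeasurableSpace (quasiSplit F E c 2).Adelic] [BorelSpace (quasiSplit F E c 2).Adelic]
    (μG : Measure (quasiSplit F E c 2).Adelic) [IsFiniteMeasureOnCompacts μG] [μG.IsOpenPosMeasure]
    {h : (quasiSplit F E c 2).Adelic → ℝ} (hh : Continuous h) (hhs : HasCompactSupport h) (h0 : ∀ x, 0 ≤ h x) (hh1 : h 1 ≠ 0) (n : ℕ) :
    (ball (0 : ℂ) (n + 2) ∩ {z : ℂ | 1 < z.re} ∩ {z : ℂ | (∫ x, (h x : ℂ) * (((borelHeight x : ℝ≥0) : ℝ) : ℂ) ^ z ∂μG).im ≠ 0}).Nonempty := by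
  obtain ⟨g₀, hg₀, hH⟩ := exists_ne_zero_one_lt_borelHeight hh hh1 (one_mem_closure_setOf_one_lt_borelHeight_two hc)
  exact uniqueSetSA_nonempty μG hh hhs h0 hg₀ hH n

end UniqueSet

/-! ## §2 THE HEAD (hypothesis-first, 2nd edition): P8 proper's letter `hunq` from ONE symmetric real test function and the `L²`-letter -/

section Head

open Summit.HodgeConjecture.HodgeConjecture.Cruxes.H413.K2E1BLBorelSpacesU2Defs
open Summit.HodgeConjecture.HodgeConjecture.Cruxes.H413.K2E1BLHeckeOperatorHXU2
open Summit.HodgeConjecture.HodgeConjecture.Cruxes.H413.K2E1SmoothedFormRepresentative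
open Summit.HodgeConjecture.HodgeConjecture.Cruxes.H413.K2E1SmoothedCuspFormConstantTerm

variable {F E : Type} [Field F] [NumberField F] [Field E] [NumberField E] [Algebra F E] {c : E ≃ₐ[F] E} {N : ℕ} [NeZero N]
  [MeasurableSpace (quasiSplit F E c N).Adelic] [BorelSpace (quasiSplit F E c N).Adelic]
  (μ : Measure (quasiSplit F E c N).automorphicQuotient) [(quasiSplit F E c N).IsAutomorphicMeasure μ]
  (νG : Measure (quasiSplit F E c N).Adelic) [νG.IsHaarMeasure] [νG.IsInvInvariant] (k : ℕ)

omit [MeasurableSpace (quasiSplit F E c N).Adelic] [BorelSpace (quasiSplit F E c N).Adelic] [(quasiSplit F E c N).IsAutomorphicMeasure μ] in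
/-- **`μ ≪ w₁^{−2k}·μ`**: the weight of `𝓗_k(𝔛)` is everywhere positive (★ `supHeight_pos`) and Borel (★ `measurable_weightX`), so `μ`-statements a.e. for the weighted measure hold `μ`-a.e.
[cite: BernsteinLapid2019, §4 p. 10] -/
theorem absolutelyContinuous_withDensity_weightX :
    μ ≪ μ.withDensity fun x => (((supHeight F E c N x)⁻¹ ^ (2 * k) : ℝ≥0) : ℝ≥0∞) :=
  withDensity_absolutelyContinuous' (measurable_weightX (F := F) (E := E) (c := c) (N := N) k).aemeasurable
    (Eventually.of_forall fun x => ENNReal.coe_ne_zero.2 (pow_ne_zero _ (inv_ne_zero (supHeight_pos (F := F) (E := E) (c := c) (N := N) x).ne')))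

omit [νG.IsInvInvariant] in
/-- **THE `L²`-BRIDGE FOR THE LETTER `hT`** (P3-C's bytes of record, ★ `exists_shiftOperatorX`: «`T u =ᵐ[w₁^{−2k}μ] fun ξ => ∫ h y · u(y⁻¹ • ξ) ∂νG`» for a continuous compactly supported `h`):
for `v ∈ 𝓗_k(𝔛)` with `v ∈ L²(μ)`, `T v ∈ L²(μ)` and its `L²`-class is `R(h)` of the class of `v` — ★ `integratedOperator_rightRegular_ae_eq_orbitalSmoothing` (`R(h)[v] =ᵐ S_h [v]`) + ★
`orbitalSmoothing_congr_ae_automorphic` (`S_h [v] = S_h v` everywhere). [cite: BernsteinLapid2019, §4 p. 10] [cite: BorelJacquet1979, §4.6] -/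
theorem exists_memLp_toLp_eq_integratedOperator_of_ae_eq {h : (quasiSplit F E c N).Adelic → ℂ} (hhc : Continuous h) (hhs : HasCompactSupport h)
    (T : HX F E c N k μ →L[ℂ] HX F E c N k μ)
    (hT : ∀ u : HX F E c N k μ, ((T u : HX F E c N k μ) : (quasiSplit F E c N).automorphicQuotient → ℂ) =ᵐ[μ.withDensity fun x => (((supHeight F E c N x)⁻¹ ^ (2 * k) : ℝ≥0) : ℝ≥0∞)]
      fun ξ => ∫ y, h y * (u : (quasiSplit F E c N).automorphicQuotient → ℂ) (y⁻¹ • ξ) ∂νG)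
    (v : HX F E c N k μ) (hv : MemLp (v : (quasiSplit F E c N).automorphicQuotient → ℂ) 2 μ) :
    ∃ hTv : MemLp ((T v : HX F E c N k μ) : (quasiSplit F E c N).automorphicQuotient → ℂ) 2 μ,
      hTv.toLp _ = ((quasiSplit F E c N).rightRegular μ).integratedOperator ((quasiSplit F E c N).isUnitary_rightRegular μ)
        ((quasiSplit F E c N).isStronglyContinuous_rightRegular_holds μ) νG ⟨⟨h, hhc⟩, hhs⟩ (hv.toLp _) := by
  haveI : SecondCountableTopology (quasiSplit F E c N).Adelic := inferInstanceAs (SecondCountableTopology (adelic F E c N ((StdForm.antidiagonal N).over E)))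
  haveI : LocallyCompactSpace (quasiSplit F E c N).Adelic := inferInstanceAs (LocallyCompactSpace (adelic F E c N ((StdForm.antidiagonal N).over E)))
  set Rφ := ((quasiSplit F E c N).rightRegular μ).integratedOperator ((quasiSplit F E c N).isUnitary_rightRegular μ)
    ((quasiSplit F E c N).isStronglyContinuous_rightRegular_holds μ) νG ⟨⟨h, hhc⟩, hhs⟩ (hv.toLp _) with hRφ
  -- `R(h)[v] =ᵐ[μ] S_h [v] = S_h v = (ξ ↦ ∫ h y · v(y⁻¹ • ξ))`
  have h1 : (Rφ : (quasiSplit F E c N).automorphicQuotient → ℂ) =ᵐ[μ] orbitalSmoothing νG h ((hv.toLp _ : (quasiSplit F E c N).L2 μ) : (quasiSplit F E c N).automorphicQuotient → ℂ) :=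
    integratedOperator_rightRegular_ae_eq_orbitalSmoothing (quasiSplit F E c N) μ νG ⟨⟨h, hhc⟩, hhs⟩ (hv.toLp _)
  have h2 : orbitalSmoothing νG h ((hv.toLp _ : (quasiSplit F E c N).L2 μ) : (quasiSplit F E c N).automorphicQuotient → ℂ) =
      fun ξ => ∫ y, h y * (v : (quasiSplit F E c N).automorphicQuotient → ℂ) (y⁻¹ • ξ) ∂νG := by
    funext ξ
    rw [orbitalSmoothing_congr_ae_automorphic (quasiSplit F E c N) μ νG h (MemLp.coeFn_toLp hv) ξ]
    simp only [orbitalSmoothing, smul_eq_mul]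
  have h3 : ((T v : HX F E c N k μ) : (quasiSplit F E c N).automorphicQuotient → ℂ) =ᵐ[μ] (Rφ : (quasiSplit F E c N).automorphicQuotient → ℂ) :=
    ((hT v).filter_mono (absolutelyContinuous_withDensity_weightX μ k).ae_le).trans (h1.trans (Eventually.of_forall fun ξ => congrFun h2 ξ)).symm
  exact ⟨(Lp.memLp Rφ).ae_eq h3.symm, ((MemLp.toLp_eq_toLp_iff _ (Lp.memLp Rφ)).2 h3).trans (Lp.toLp_coeFn Rφ (Lp.memLp Rφ))⟩

/-- **P6′ HEAD — P8 PROPER'S LETTER `hunq`, «L² + SELF-ADJOINT», THRESHOLD-PARAMETRIC AND RANK-GENERIC** (the bytes of ★ `sphericalEisenstein_meromorphicOn_ball_of_letters`' `hunq` with `ι P α₁ α₂ Q`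
abstract and `1 < Re z` generalised to `σ₀ < Re z`).  Data: `X = 𝓗_k(𝔛) = HX k μ` (★ leaf 1) for an automorphic `μ`; an inversion-invariant Haar measure `νG`; test functions `h i`, continuous of
compact support, among which ONE, `h i₀`, is SYMMETRIC and REAL (`h(g⁻¹) = h(g) = conj h(g)`: the amended spec `h := η^∨ ∗ η`) and has `Im ĥ_{i₀}` non-zero somewhere on `ball 0 (n+2) ∩ {σ₀ < Re}`
(letter `hne`, §1.3 — discharged at `N = 2` below), `ĥ_i(z) = ∫ h_i(x) H(x)^z ∂νG`; Hecke operators `T i : X →L X`, with `T i₀` of P3-C's shape (letter `hT`, ★ `exists_shiftOperatorX`); the packaged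
system's concrete letters `ι P α₁ α₂ Q φ₀`; the GIVEN solution `(eX, bX)` on `ball ∩ {σ₀ < Re}` (`hsolT hsolC hsolQ`, ★ P8 §2's bytes); and the `L²`-LETTER `hL2` (item (i) of the ruling:
at a point of `U₀ := ball 0 (n+2) ∩ {σ₀ < Re} ∩ {Im ĥ_{i₀} ≠ 0}` a HOMOGENEOUS solution — `T i ψ = ĥ_i(z)ψ` for all `i`, `P(ιψ) ∈ ℂ·α₂(z)`, `Q ψ = 0` — has `ψ ∈ L²(μ)`).  THEN `U₀` is open
(★ P5: `ĥ` entire), non-empty, inside `ball ∩ {σ₀ < Re}`, and every solution `(ψ, b)` at `z ∈ U₀` has **`ψ = eX z`**: `ψ′ = ψ − eX z` is homogeneous, so in `L²(μ)` (`hL2`); its `L²`-class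
is an eigenvector of the SELF-ADJOINT `R(h_{i₀})` (§1.1 + the bridge) with the NON-REAL eigenvalue `ĥ_{i₀}(z)`, hence `0` (§1.2); and `μ`, `w₁^{−2k}μ` are mutually absolutely continuous.
[cite: BernsteinLapid2019, §4 Claim 2 (p. 9), Thm 2.3] [cite: MoeglinWaldspurger1995, IV.1.9] -/
theorem hunq_of_memLp_of_lt (σ₀ : ℝ) (n : ℕ) {I : Type*} (i₀ : I) {h : I → (quasiSplit F E c N).Adelic → ℂ}
    (hhc : ∀ i, Continuous (h i)) (hhs : ∀ i, HasCompactSupport (h i)) (hsymm : ∀ g, h i₀ g⁻¹ = h i₀ g) (hreal : ∀ g, conj (h i₀ g) = h i₀ g)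
    (hne : (ball (0 : ℂ) (n + 2) ∩ {z : ℂ | σ₀ < z.re} ∩ {z : ℂ | (∫ x, h i₀ x * (((borelHeight x : ℝ≥0) : ℝ) : ℂ) ^ z ∂νG).im ≠ 0}).Nonempty)
    (T : I → HX F E c N k μ →L[ℂ] HX F E c N k μ)
    (hT : ∀ u : HX F E c N k μ, ((T i₀ u : HX F E c N k μ) : (quasiSplit F E c N).automorphicQuotient → ℂ) =ᵐ[μ.withDensity fun x => (((supHeight F E c N x)⁻¹ ^ (2 * k) : ℝ≥0) : ℝ≥0∞)]
      fun ξ => ∫ y, h i₀ y * (u : (quasiSplit F E c N).automorphicQuotient → ℂ) (y⁻¹ • ξ) ∂νG)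
    {V : Type*} [NormedAddCommGroup V] [NormedSpace ℂ V] (ι : HX F E c N k μ →L[ℂ] V) (P : V →L[ℂ] V) (α₁ α₂ : ℂ → V)
    {X' : Type*} [NormedAddCommGroup X'] [NormedSpace ℂ X'] (Q : HX F E c N k μ →L[ℂ] X') (φ₀ : ℂ) (eX : ℂ → HX F E c N k μ) (bX : ℂ → ℂ)
    (hsolT : ∀ z ∈ ball (0 : ℂ) (n + 2), σ₀ < z.re → ∀ i, T i (eX z) = (∫ x, h i x * (((borelHeight x : ℝ≥0) : ℝ) : ℂ) ^ z ∂νG) • eX z)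
    (hsolC : ∀ z ∈ ball (0 : ℂ) (n + 2), σ₀ < z.re → P (ι (eX z)) = φ₀ • α₁ z + bX z • α₂ z)
    (hsolQ : ∀ z ∈ ball (0 : ℂ) (n + 2), σ₀ < z.re → Q (eX z) = 0)
    (hL2 : ∀ z ∈ ball (0 : ℂ) (n + 2), σ₀ < z.re → (∫ x, h i₀ x * (((borelHeight x : ℝ≥0) : ℝ) : ℂ) ^ z ∂νG).im ≠ 0 →
      ∀ (ψ : HX F E c N k μ) (b' : ℂ), (∀ i, T i ψ = (∫ x, h i x * (((borelHeight x : ℝ≥0) : ℝ) : ℂ) ^ z ∂νG) • ψ) → P (ι ψ) = b' • α₂ z → Q ψ = 0 →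
        MemLp (ψ : (quasiSplit F E c N).automorphicQuotient → ℂ) 2 μ) :
    ∃ U₀ : Set ℂ, IsOpen U₀ ∧ U₀.Nonempty ∧ U₀ ⊆ ball (0 : ℂ) (n + 2) ∩ {z : ℂ | σ₀ < z.re} ∧
      ∀ z ∈ U₀, ∀ (ψ : HX F E c N k μ) (b : ℂ), (∀ i, T i ψ = (∫ x, h i x * (((borelHeight x : ℝ≥0) : ℝ) : ℂ) ^ z ∂νG) • ψ) →
        P (ι ψ) = φ₀ • α₁ z + b • α₂ z → Q ψ = 0 → ψ = eX z := by
  refine ⟨ball (0 : ℂ) (n + 2) ∩ {z : ℂ | σ₀ < z.re} ∩ {z : ℂ | (∫ x, h i₀ x * (((borelHeight x : ℝ≥0) : ℝ) : ℂ) ^ z ∂νG).im ≠ 0}, ?_, hne, inter_subset_left, ?_⟩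
  · exact (isOpen_ball.inter (isOpen_lt continuous_const Complex.continuous_re)).inter
      (isOpen_ne_fun (Complex.continuous_im.comp (differentiable_integral_mul_borelHeight_cpow νG (hhc i₀) (hhs i₀)).continuous) continuous_const)
  rintro z ⟨⟨hzb, hzσ⟩, hzim⟩ ψ b hTψ hPψ hQψ
  -- the difference `ψ - eX z` is a HOMOGENEOUS solution
  have hT' : ∀ i, T i (ψ - eX z) = (∫ x, h i x * (((borelHeight x : ℝ≥0) : ℝ) : ℂ) ^ z ∂νG) • (ψ - eX z) := fun i => by
    rw [map_sub, hTψ i, hsolT z hzb hzσ i, smul_sub]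
  have hP' : P (ι (ψ - eX z)) = (b - bX z) • α₂ z := by
    rw [map_sub, map_sub, hPψ, hsolC z hzb hzσ, sub_smul]; abel
  have hQ' : Q (ψ - eX z) = 0 := by rw [map_sub, hQψ, hsolQ z hzb hzσ, sub_zero]
  -- hence in `L²(μ)` (the letter), where its class is an eigenvector of the self-adjoint `R(h i₀)` with the non-real eigenvalue `ĥ_{i₀}(z)`
  have hL : MemLp ((ψ - eX z : HX F E c N k μ) : (quasiSplit F E c N).automorphicQuotient → ℂ) 2 μ := hL2 z hzb hzσ hzim (ψ - eX z) (b - bX z) hT' hP' hQ'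
  obtain ⟨hTv, hcomp⟩ := exists_memLp_toLp_eq_integratedOperator_of_ae_eq μ νG k (hhc i₀) (hhs i₀) (T i₀) hT (ψ - eX z) hL
  have hμw := absolutelyContinuous_withDensity_weightX (F := F) (E := E) (c := c) (N := N) μ k
  have hwμ : (μ.withDensity fun x => (((supHeight F E c N x)⁻¹ ^ (2 * k) : ℝ≥0) : ℝ≥0∞)) ≪ μ := withDensity_absolutelyContinuous μ _
  have hae : ((T i₀ (ψ - eX z) : HX F E c N k μ) : (quasiSplit F E c N).automorphicQuotient → ℂ) =ᵐ[μ]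
      (∫ x, h i₀ x * (((borelHeight x : ℝ≥0) : ℝ) : ℂ) ^ z ∂νG) • ((ψ - eX z : HX F E c N k μ) : (quasiSplit F E c N).automorphicQuotient → ℂ) := by
    have h1 : ((T i₀ (ψ - eX z) : HX F E c N k μ) : (quasiSplit F E c N).automorphicQuotient → ℂ) =ᵐ[μ.withDensity fun x => (((supHeight F E c N x)⁻¹ ^ (2 * k) : ℝ≥0) : ℝ≥0∞)]
        (((∫ x, h i₀ x * (((borelHeight x : ℝ≥0) : ℝ) : ℂ) ^ z ∂νG) • (ψ - eX z) : HX F E c N k μ) : (quasiSplit F E c N).automorphicQuotient → ℂ) := by rw [hT' i₀]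
    exact (h1.trans (Lp.coeFn_smul _ _)).filter_mono hμw.ae_le
  have heig : ((quasiSplit F E c N).rightRegular μ).integratedOperator ((quasiSplit F E c N).isUnitary_rightRegular μ)
        ((quasiSplit F E c N).isStronglyContinuous_rightRegular_holds μ) νG ⟨⟨h i₀, hhc i₀⟩, hhs i₀⟩ (hL.toLp _) =
      (∫ x, h i₀ x * (((borelHeight x : ℝ≥0) : ℝ) : ℂ) ^ z ∂νG) • hL.toLp _ := by
    rw [← hcomp, ← MemLp.toLp_const_smul]
    exact (MemLp.toLp_eq_toLp_iff hTv (hL.const_smul _)).2 hae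
  have hzero : hL.toLp _ = 0 :=
    eq_zero_of_integratedOperator_rightRegular_eq_smul (quasiSplit F E c N) μ νG ⟨⟨h i₀, hhc i₀⟩, hhs i₀⟩ hsymm hreal hzim heig
  -- back to `X`: `ψ - eX z = 0`
  have hae0 : ((ψ - eX z : HX F E c N k μ) : (quasiSplit F E c N).automorphicQuotient → ℂ) =ᵐ[μ] 0 := by
    have h0 := MemLp.coeFn_toLp hL
    rw [hzero] at h0
    exact ((Lp.coeFn_zero ℂ 2 μ).symm.trans h0).symm
  exact sub_eq_zero.1 (Lp.eq_zero_iff_ae_eq_zero.2 (hae0.filter_mono hwμ.ae_le))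

/-- **P6′ HEAD AT `N = 2` — P8 PROPER'S LETTER `hunq` VERBATIM** (`σ₀ = 1`; `c² = 1`): as `hunq_of_memLp_of_lt`, with the non-emptiness of `U₀` DISCHARGED by §1.3 (★ `uniqueSetSA_nonempty_two`) from
`Re h_{i₀} ≥ 0` and `h_{i₀}(1) ≠ 0` — automatic for the amended spec's `h = η^∨ ∗ η` (`h ≥ 0`, `h(1) = ‖η‖₂² > 0`).  The closer instantiates `ι := iota hb`, `P := cnstN k a μZ`, `α₁ α₂` the
★ P8-β vectors, `Q`, `(eX, bX)` = K2E4-p23's «E_z solves the 𝔛-system», and is left with the single `L²`-letter `hL2` (item (i), §3). [cite: BernsteinLapid2019, §4 Claim 2 (p. 9), Thm 2.3] -/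
theorem hunq_of_memLp_two {F E : Type} [Field F] [NumberField F] [Field E] [NumberField E] [Algebra F E] {c : E ≃ₐ[F] E} (hc : c * c = 1)
    [MeasurableSpace (quasiSplit F E c 2).Adelic] [BorelSpace (quasiSplit F E c 2).Adelic]
    (μ : Measure (quasiSplit F E c 2).automorphicQuotient) [(quasiSplit F E c 2).IsAutomorphicMeasure μ]
    (νG : Measure (quasiSplit F E c 2).Adelic) [νG.IsHaarMeasure] [νG.IsInvInvariant] (k n : ℕ) {I : Type*} (i₀ : I) {h : I → (quasiSplit F E c 2).Adelic → ℂ}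
    (hhc : ∀ i, Continuous (h i)) (hhs : ∀ i, HasCompactSupport (h i)) (hsymm : ∀ g, h i₀ g⁻¹ = h i₀ g) (hreal : ∀ g, conj (h i₀ g) = h i₀ g)
    (h0 : ∀ g, 0 ≤ (h i₀ g).re) (hh1 : h i₀ 1 ≠ 0)
    (T : I → HX F E c 2 k μ →L[ℂ] HX F E c 2 k μ)
    (hT : ∀ u : HX F E c 2 k μ, ((T i₀ u : HX F E c 2 k μ) : (quasiSplit F E c 2).automorphicQuotient → ℂ) =ᵐ[μ.withDensity fun x => (((supHeight F E c 2 x)⁻¹ ^ (2 * k) : ℝ≥0) : ℝ≥0∞)]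
      fun ξ => ∫ y, h i₀ y * (u : (quasiSplit F E c 2).automorphicQuotient → ℂ) (y⁻¹ • ξ) ∂νG)
    {V : Type*} [NormedAddCommGroup V] [NormedSpace ℂ V] (ι : HX F E c 2 k μ →L[ℂ] V) (P : V →L[ℂ] V) (α₁ α₂ : ℂ → V)
    {X' : Type*} [NormedAddCommGroup X'] [NormedSpace ℂ X'] (Q : HX F E c 2 k μ →L[ℂ] X') (φ₀ : ℂ) (eX : ℂ → HX F E c 2 k μ) (bX : ℂ → ℂ)
    (hsolT : ∀ z ∈ ball (0 : ℂ) (n + 2), 1 < z.re → ∀ i, T i (eX z) = (∫ x, h i x * (((borelHeight x : ℝ≥0) : ℝ) : ℂ) ^ z ∂νG) • eX z)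
    (hsolC : ∀ z ∈ ball (0 : ℂ) (n + 2), 1 < z.re → P (ι (eX z)) = φ₀ • α₁ z + bX z • α₂ z)
    (hsolQ : ∀ z ∈ ball (0 : ℂ) (n + 2), 1 < z.re → Q (eX z) = 0)
    (hL2 : ∀ z ∈ ball (0 : ℂ) (n + 2), 1 < z.re → (∫ x, h i₀ x * (((borelHeight x : ℝ≥0) : ℝ) : ℂ) ^ z ∂νG).im ≠ 0 →
      ∀ (ψ : HX F E c 2 k μ) (b' : ℂ), (∀ i, T i ψ = (∫ x, h i x * (((borelHeight x : ℝ≥0) : ℝ) : ℂ) ^ z ∂νG) • ψ) → P (ι ψ) = b' • α₂ z → Q ψ = 0 →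
        MemLp (ψ : (quasiSplit F E c 2).automorphicQuotient → ℂ) 2 μ) :
    ∃ U₀ : Set ℂ, IsOpen U₀ ∧ U₀.Nonempty ∧ U₀ ⊆ ball (0 : ℂ) (n + 2) ∩ {z : ℂ | 1 < z.re} ∧
      ∀ z ∈ U₀, ∀ (ψ : HX F E c 2 k μ) (b : ℂ), (∀ i, T i ψ = (∫ x, h i x * (((borelHeight x : ℝ≥0) : ℝ) : ℂ) ^ z ∂νG) • ψ) →
        P (ι ψ) = φ₀ • α₁ z + b • α₂ z → Q ψ = 0 → ψ = eX z := by
  have hre : ∀ g, (((h i₀ g).re : ℝ) : ℂ) = h i₀ g := fun g => Complex.conj_eq_iff_re.1 (hreal g)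
  refine hunq_of_memLp_of_lt μ νG k 1 n i₀ hhc hhs hsymm hreal ?_ T hT ι P α₁ α₂ Q φ₀ eX bX hsolT hsolC hsolQ hL2
  have hne := uniqueSetSA_nonempty_two hc νG (h := fun g => (h i₀ g).re) (Complex.continuous_re.comp (hhc i₀)) ((hhs i₀).comp_left Complex.zero_re) h0
    (fun h01 => hh1 (by rw [← hre 1, h01, Complex.ofReal_zero])) n
  have hfun : h i₀ = fun g => (((h i₀ g).re : ℝ) : ℂ) := funext fun g => (hre g).symm
  rw [hfun]
  exact hne

end Head

end Summit.HodgeConjecture.HodgeConjecture.Cruxes.H413.K2E1BLUniquenessSelfAdjointU2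

end
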